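import Summits.MatrixMultiplication.MatrixMultiplication.Theorems.PairwiseCurvedTilingsLC.Negative.GenericInterior
import Summits.MatrixMultiplication.MatrixMultiplication.Theorems.PairwiseCurvedTilingsLC.Negative.PointIdealMaximal
import Summits.MatrixMultiplication.MatrixMultiplication.Theorems.PairwiseCurvedTilingsLC.Negative.FiniteZerosFinOne
import Literature.ModelTheory.PseudofiniteFields.DefinableSetsToolkit
import Literature.ModelTheory.PseudofiniteFields.EtaleImagePullback

/-!
# The chart induction, Case 1: an infinite fibre gives a coordinate-line chart
(line LonelyTranslates c1, Prop27Reduction; part of the proof of `stub_openPiece`)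

If a definable `A ⊆ K^{m+1}` (char-`0` pseudo-finite `K`) has an infinite fibre
`{t | (b, t) ∈ A}` over some `b ∈ K^m`, then `A` carries a GOOD CHART with one free coordinate
(the last one) and bound coordinates `w_j = b_j`: the chart set is `X = {(b, t) ∈ A | D₁(t) ≠ 0}`
where `D₁ ≠ 0` is the exceptional polynomial of the fibre given by `stub_genericInterior`; `X` is
relatively étale-open in the line `{x' = b}` (pull back the one-variable neighbourhoods),
Zariski-dense along the free coordinate (it is infinite, and a non-zero one-variable polynomial
has finitely many zeros), definable, and the chart ideal `(w_j − b_j)_j ⊆ F[w]` is maximal.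
-/

set_option linter.dupNamespace false

namespace Summit.MatrixMultiplication.MatrixMultiplication.Theorems.PairwiseCurvedTilingsLC.Negative

open FirstOrder FirstOrder.Language FirstOrder.Ring
open Literature.ModelTheory.PseudofiniteFields

section LineChart

variable {K : Type} [Field K] {m : ℕ}

/-- The set `{x ∈ K^{m+1} | x' = b, x ∈ A, D₁(x_last) ≠ 0}` of the line chart is definable.
[folklore] -/
theorem definable_lineChartSet [CompatibleRing K] (b : Fin m → K) {A : Set (Fin (m + 1) → K)}
    (hA : ∃ (n : ℕ) (φ : Language.ring.Formula (Fin (m + 1) ⊕ Fin n)) (y : Fin n → K),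
      A = {x | φ.Realize (Sum.elim x y)})
    (D₁ : MvPolynomial (Fin 1) K) :
    ∃ (n : ℕ) (φ : Language.ring.Formula (Fin (m + 1) ⊕ Fin n)) (y : Fin n → K),
      {x : Fin (m + 1) → K | (∀ j : Fin m, x (Fin.castSucc j) = b j) ∧ x ∈ A ∧
        MvPolynomial.eval (fun _ : Fin 1 => x (Fin.last m)) D₁ ≠ 0} =
        {x | φ.Realize (Sum.elim x y)} := by
  -- the three pieces
  have h1 : ∃ (n : ℕ) (φ : Language.ring.Formula (Fin (m + 1) ⊕ Fin n)) (y : Fin n → K),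
      {x : Fin (m + 1) → K | ∀ j : Fin m, x (Fin.castSucc j) = b j} =
        {x | φ.Realize (Sum.elim x y)} := by
    obtain ⟨θ, hθ⟩ := definable_vecEq (α := Fin (m + 1) ⊕ Fin m)
      (fun j : Fin m => Sum.inl (Fin.castSucc j)) (fun j => Sum.inr j)
    refine ⟨m, θ, b, Set.ext fun x => ?_⟩
    simp only [Set.mem_setOf_eq, hθ K, Sum.elim_inl, Sum.elim_inr]
    exact ⟨fun h => funext h, fun h j => congrFun h j⟩
  have h3 : ∃ (n : ℕ) (φ : Language.ring.Formula (Fin (m + 1) ⊕ Fin n)) (y : Fin n → K),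
      {x : Fin (m + 1) → K | MvPolynomial.eval (fun _ : Fin 1 => x (Fin.last m)) D₁ ≠ 0} =
        {x | φ.Realize (Sum.elim x y)} := by
    obtain ⟨n, φ, y, h⟩ := definableSet_preimage_subst (K := K) (m := 1) (m' := m + 1) (p := 0)
      (fun _ => Sum.inl (Fin.last m)) Fin.elim0 (definableSet_eval_ne_zero (K := K) D₁)
    exact ⟨n, φ, y, h⟩
  obtain ⟨n, φ, y, h⟩ := definableSet_inter (definableSet_inter h1 hA) h3
  refine ⟨n, φ, y, ?_⟩
  rw [← h]
  ext x
  simp only [Set.mem_inter_iff, Set.mem_setOf_eq, and_assoc]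

/-- **Case 1 of the chart induction (line chart).** -/
theorem chartLine (h27 : ChatzidakisVanDenDriesMacintyre1992_prop27)
    (K : Type) [Field K] [CompatibleRing K] [CharZero K] (hK : K ⊨ finiteFieldTheory)
    {m n : ℕ} (φ : Language.ring.Formula (Fin (m + 1) ⊕ Fin n)) (y : Fin n → K)
    (b : Fin m → K)
    (hb : {t : K | φ.Realize (Sum.elim (Fin.snoc b t : Fin (m + 1) → K) y)}.Infinite) :
    ∃ (e k : ℕ) (σ : Fin (m + 1) ≃ Fin e ⊕ Fin k) (D : Fin k → MvPolynomial (Fin e ⊕ Fin k) K)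
      (X : Set (Fin (m + 1) → K)),
      1 ≤ e ∧
      (∀ j i : Fin k, i < j → MvPolynomial.pderiv (Sum.inr i) (D j) = 0) ∧
      (Ideal.span (Set.range fun j => MvPolynomial.aeval
        (Sum.elim (fun i => MvPolynomial.C (algebraMap (MvPolynomial (Fin e) K)
          (FractionRing (MvPolynomial (Fin e) K)) (MvPolynomial.X i)))
          (fun j => MvPolynomial.X j)) (D j) :
            Set (MvPolynomial (Fin k) (FractionRing (MvPolynomial (Fin e) K))))).IsMaximal ∧
      X ⊆ {x | φ.Realize (Sum.elim x y)} ∧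
      (∀ x ∈ X, (∀ j, MvPolynomial.eval (x ∘ σ.symm) (D j) = 0) ∧
        ∀ j, MvPolynomial.eval (x ∘ σ.symm) (MvPolynomial.pderiv (Sum.inr j) (D j)) ≠ 0) ∧
      (∀ x ∈ X, ∃ (r : ℕ) (E : EtaleDatum K (m + 1) r), x ∈ E.image ∧ ∀ x' ∈ E.image,
        (∀ j, MvPolynomial.eval (x' ∘ σ.symm) (D j) = 0) →
        (∀ j, MvPolynomial.eval (x' ∘ σ.symm) (MvPolynomial.pderiv (Sum.inr j) (D j)) ≠ 0) →
          x' ∈ X) ∧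
      (∀ c : MvPolynomial (Fin e) K, c ≠ 0 →
        ∃ x ∈ X, MvPolynomial.eval (fun i => x (σ.symm (Sum.inl i))) c ≠ 0) ∧
      (∃ (n' : ℕ) (ψ : Language.ring.Formula (Fin (m + 1) ⊕ Fin n')) (z : Fin n' → K),
        X = {x | ψ.Realize (Sum.elim x z)}) := by
  classical
  haveI : Infinite K := Infinite.of_injective (Nat.cast : ℕ → K) Nat.cast_injective
  -- the fibre as a definable subset of `K^1`
  set A : Set (Fin (m + 1) → K) := {x | φ.Realize (Sum.elim x y)} with hA
  have hAdef : ∃ (n : ℕ) (φ' : Language.ring.Formula (Fin (m + 1) ⊕ Fin n)) (y' : Fin n → K),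
      A = {x | φ'.Realize (Sum.elim x y')} := ⟨n, φ, y, rfl⟩
  have hsnoc : ∀ v : Fin 1 → K, (fun i => Sum.elim v b
      ((Fin.lastCases (Sum.inl 0) Sum.inr : Fin (m + 1) → Fin 1 ⊕ Fin m) i)) =
      (Fin.snoc b (v 0) : Fin (m + 1) → K) := by
    intro v
    funext i
    cases i using Fin.lastCases with
    | last => simp
    | cast j => simp
  obtain ⟨n₁, φ₁, y₁, hF₁⟩ := definableSet_preimage_subst (K := K) (m := m + 1) (m' := 1) (p := m)
    (Fin.lastCases (Sum.inl 0) Sum.inr) b hAdef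
  -- `F₁ = {v | snoc b (v 0) ∈ A}`
  have hF₁' : ∀ v : Fin 1 → K, φ₁.Realize (Sum.elim v y₁) ↔
      (Fin.snoc b (v 0) : Fin (m + 1) → K) ∈ A := by
    intro v
    have := Set.ext_iff.1 hF₁ v
    simp only [Set.mem_setOf_eq] at this
    rw [← this, hsnoc]
  -- the exceptional polynomial of the fibre
  obtain ⟨D₁, hD₁0, hint⟩ := stub_genericInterior h27 K hK φ₁ y₁
  -- the chart set
  set X : Set (Fin (m + 1) → K) := {x | (∀ j : Fin m, x (Fin.castSucc j) = b j) ∧ x ∈ A ∧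
    MvPolynomial.eval (fun _ : Fin 1 => x (Fin.last m)) D₁ ≠ 0} with hX
  -- the coordinate equivalence: last coordinate free, the others bound
  let σ : Fin (m + 1) ≃ Fin 1 ⊕ Fin m :=
    { toFun := Fin.lastCases (Sum.inl 0) Sum.inr
      invFun := Sum.elim (fun _ => Fin.last m) Fin.castSucc
      left_inv := fun i => by
        cases i using Fin.lastCases with
        | last => simp
        | cast j => simp
      right_inv := fun s => by
        rcases s with u | j
        · have : u = 0 := Subsingleton.elim _ _
          subst this; simp
        · simp }
  have hσl : ∀ u, σ.symm (Sum.inl u) = Fin.last m := fun _ => rfl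
  have hσr : ∀ j, σ.symm (Sum.inr j) = Fin.castSucc j := fun _ => rfl
  -- points of `X` are `snoc b t`
  have hXsnoc : ∀ x : Fin (m + 1) → K, (∀ j : Fin m, x (Fin.castSucc j) = b j) →
      x = Fin.snoc b (x (Fin.last m)) := by
    intro x hx
    funext i
    cases i using Fin.lastCases with
    | last => simp
    | cast j => simp [hx j]
  refine ⟨1, m, σ, fun j => MvPolynomial.X (Sum.inr j) - MvPolynomial.C (b j), X, le_rfl,
    ?_, ?_, ?_, ?_, ?_, ?_, ?_⟩
  · -- triangular (indeed diagonal)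
    intro j i hij
    simp [MvPolynomial.pderiv_X, (ne_of_lt hij).symm]
  · -- the chart ideal is the point ideal of `b`
    have hrange : (Set.range fun j : Fin m => MvPolynomial.aeval
        (Sum.elim (fun i => MvPolynomial.C (algebraMap (MvPolynomial (Fin 1) K)
          (FractionRing (MvPolynomial (Fin 1) K)) (MvPolynomial.X i)))
          (fun j => MvPolynomial.X j)) (MvPolynomial.X (Sum.inr j) - MvPolynomial.C (b j)) :
            Set (MvPolynomial (Fin m) (FractionRing (MvPolynomial (Fin 1) K)))) =
        Set.range fun j : Fin m => (MvPolynomial.X j - MvPolynomial.C (algebraMap K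
          (FractionRing (MvPolynomial (Fin 1) K)) (b j)) :
            MvPolynomial (Fin m) (FractionRing (MvPolynomial (Fin 1) K))) := by
      congr 1
      funext j
      simp only [map_sub, MvPolynomial.aeval_X, Sum.elim_inr, MvPolynomial.aeval_C,
        MvPolynomial.algebraMap_apply]
    rw [hrange]
    exact stub_span_X_sub_C_isMaximal _
  · -- `X ⊆ A`
    intro x hx; exact hx.2.1
  · -- points of `X` lie on the chart
    intro x hx
    refine ⟨fun j => ?_, fun j => ?_⟩
    · simp [hσr, hx.1 j]
    · simp [MvPolynomial.pderiv_X]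
  · -- relative openness
    intro x hx
    obtain ⟨hxb, hxA, hxD⟩ := hx
    set v : Fin 1 → K := fun _ => x (Fin.last m) with hv
    have hvF : φ₁.Realize (Sum.elim v y₁) := by
      rw [hF₁', ← hXsnoc x hxb]; exact hxA
    obtain ⟨r, E₁, hvE₁, hE₁F⟩ := hint v hvF hxD
    obtain ⟨E₀, hE₀⟩ := EtaleDatum.exists_image_eq_setOf_eval_ne_zero (K := K) D₁
    obtain ⟨E₂, hE₂⟩ := E₁.exists_image_eq_inter E₀
    obtain ⟨E, hE⟩ := E₂.exists_image_eq_preimage_comp (fun _ : Fin 1 => Fin.last m)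
    refine ⟨_, E, ?_, fun x' hx' hD hpd => ?_⟩
    · rw [hE, Set.mem_setOf_eq, hE₂, hE₀]
      exact ⟨hvE₁, hxD⟩
    · rw [hE, Set.mem_setOf_eq, hE₂, hE₀] at hx'
      obtain ⟨hx'E₁, hx'D⟩ := hx'
      have hx'b : ∀ j : Fin m, x' (Fin.castSucc j) = b j := by
        intro j
        have := hD j
        simp [hσr, sub_eq_zero] at this
        exact this
      refine ⟨hx'b, ?_, hx'D⟩
      have hmem := hE₁F hx'E₁
      simp only [Set.mem_setOf_eq] at hmem
      rw [hF₁'] at hmem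
      rw [hXsnoc x' hx'b]
      exact hmem
  · -- Zariski density along the free coordinate
    intro c hc
    have hXinf : ({v : Fin 1 → K | φ₁.Realize (Sum.elim v y₁)} ∩
        {v | MvPolynomial.eval v D₁ ≠ 0}).Infinite := by
      have h1 : {v : Fin 1 → K | φ₁.Realize (Sum.elim v y₁)}.Infinite := by
        have himage : (fun t : K => (fun _ : Fin 1 => t)) ''
            {t : K | φ.Realize (Sum.elim (Fin.snoc b t : Fin (m + 1) → K) y)} ⊆
            {v : Fin 1 → K | φ₁.Realize (Sum.elim v y₁)} := by
          rintro _ ⟨t, ht, rfl⟩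
          simp only [Set.mem_setOf_eq, hF₁']
          exact ht
        refine Set.Infinite.mono himage (hb.image ?_)
        intro t₁ _ t₂ _ h
        exact congrFun h 0
      have h2 : {v : Fin 1 → K | φ₁.Realize (Sum.elim v y₁)} ∩ {v | MvPolynomial.eval v D₁ ≠ 0} =
          {v : Fin 1 → K | φ₁.Realize (Sum.elim v y₁)} \ {v | MvPolynomial.eval v D₁ = 0} := by
        ext v; simp
      rw [h2]
      exact h1.sdiff (stub_finite_zeros_fin_one D₁ hD₁0)
    obtain ⟨v, ⟨hvF, hvD⟩, hvc⟩ := (hXinf.sdiff (stub_finite_zeros_fin_one c hc)).nonempty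
    simp only [Set.mem_setOf_eq] at hvc
    have hvv : (fun _ : Fin 1 => v 0) = v := funext fun i => by rw [Subsingleton.elim i 0]
    refine ⟨Fin.snoc b (v 0), ⟨fun j => by simp, ?_, ?_⟩, ?_⟩
    · exact (hF₁' v).1 hvF
    · simp only [Fin.snoc_last, hvv]; exact hvD
    · simp only [hσl, Fin.snoc_last, hvv]; exact hvc
  · -- definability
    exact definable_lineChartSet b hAdef D₁

end LineChart

end Summit.MatrixMultiplication.MatrixMultiplication.Theorems.PairwiseCurvedTilingsLC.Negative
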